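import Summits.HubbardSuperconductivity.HubbardSuperconductivity.Theorems.AnisotropyChordTransferFibre3N1RowL2RegionZ
import Summits.HubbardSuperconductivity.HubbardSuperconductivity.Theorems.AnisotropyChordTransferFibre3N1RowL2RegionB

/-!
# Route `AnisotropyChord` / H0 rotor rung, LEVEL 2 row `N₁`: the ∀L ≥ 128 TRIAL-GAP CERTIFICATE in `TrialGapAbs` form

The Level-2 kernel certificate of the (KT-1″) row (p2 g4–g5 on theory-1 g22's PartN41-B and p1 g26–g27's proofs) as it is
consumed by the GM₃ assembly (`gm3_allL`, hypothesis `TrialGapAbs L Δ c`):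
★★★ `trialGapAbs_L2`: for every `L ≥ 128` and every `0 ≤ Δ < 1` whose ground profile has `ν = λ₂/θ² ≥ 2.39·10⁻⁴`
(equivalently `η_eff = (1 − Δ)f_nn ≥ 2.39·10⁻⁴π²`, i.e. `Δ` not within `≈ 2·10⁻³` of `1`): `TrialGapAbs L Δ (3/10)`;
★ `trialGapAbs_L2'`: with `ν ≥ 4.79·10⁻⁴` the constant `17/50 = 0.34`.
Both are one-line wrappers of `trialGap_L2_aboveZ` (p2 g5 …N1RowL2RegionZ: 64 `ν`-columns `[0.000239, 0.031]`, 334 kernel cells)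
resp. `trialGap_L2_aboveB`; per-column constants (mostly `≥ 0.40`) are in HOME/hubbard-h0-rotor-p2/cells/CONSTANTS.md.
The corner `ν < 2.39·10⁻⁴` (`Δ → 1⁻`, where `U′, N₁′ → 0`) is NOT covered here (needs the symbolic `ν`-factoring; theory/p1).
Prover seat `hubbard-h0-rotor-p2` g5; helper for piece A = stmt-HubbardSuperconductivity-23918 of rung 19089
(`--supports`, helper class).  WHAT THIS IS NOT: nothing here proves superconductivity in the Hubbard model, nor GM₃ itself:
it discharges the (KT-1″) hypothesis of the conditional GM₃ reduction for all `L ≥ 128` away from the corner `Δ → 1`; the rotor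
TARGET as originally worded stays FALSE (g15 verdict).  Mathlib + the tree only; no sorry.
-/

set_option linter.dupNamespace false
set_option autoImplicit false

open Literature.Analysis.ValidatedNumerics

namespace Summit.HubbardSuperconductivity.HubbardSuperconductivity.Theorems.AnisotropyChord.Transfer.Fibre3.L2.N1

variable (L : ℕ) [NeZero L]

/-- ★★★ `TrialGapAbs L Δ (3/10)` for every `L ≥ 128`, `0 ≤ Δ < 1`, provided the ground profile has `ν = λ₂/θ² ≥ 2.39·10⁻⁴`. -/
theorem trialGapAbs_L2 (hL : 128 ≤ L) {Δ : ℝ} (hΔ0 : 0 ≤ Δ) (hΔ1 : Δ < 1)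
    (hν : ∀ lam2 : ℝ, ∀ f : Tor L → ℝ, IsGroundTwoMagnon L Δ lam2 f → (239 : ℝ) / 1000000 ≤ lam2 / (2 * Real.pi / L) ^ 2) :
    TrialGapAbs L Δ (3 / 10) := by
  intro lam2 f hf
  have h := trialGap_L2_aboveZ L hL hΔ0 hΔ1 hf (hν lam2 f hf)
  norm_num at h ⊢
  exact h

/-- ★ the same with the better constant `17/50` above `ν ≥ 4.79·10⁻⁴`. -/
theorem trialGapAbs_L2' (hL : 128 ≤ L) {Δ : ℝ} (hΔ0 : 0 ≤ Δ) (hΔ1 : Δ < 1)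
    (hν : ∀ lam2 : ℝ, ∀ f : Tor L → ℝ, IsGroundTwoMagnon L Δ lam2 f → (479 : ℝ) / 1000000 ≤ lam2 / (2 * Real.pi / L) ^ 2) :
    TrialGapAbs L Δ (17 / 50) := by
  intro lam2 f hf
  have h := trialGap_L2_aboveB L hL hΔ0 hΔ1 hf (hν lam2 f hf)
  norm_num at h ⊢
  exact h

/-- ★ the `η_eff` form of the side condition: `ν = η_eff/π²` (manifold dictionary (vii)), `η_eff = (1 − Δ)·f(x̂)` (`etaEff_eq`);
so `ν ≥ ν₀` iff `(1 − Δ)·f(x̂) ≥ π²ν₀`. -/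
theorem nu_eq_etaEff_div (hL : 128 ≤ L) {Δ lam2 : ℝ} (hΔ0 : 0 ≤ Δ) (hΔ1 : Δ < 1) {f : Tor L → ℝ}
    (hf : IsGroundTwoMagnon L Δ lam2 f) :
    lam2 / (2 * Real.pi / L) ^ 2 = (1 - Δ) * f (K1 L) / Real.pi ^ 2 := by
  obtain ⟨_, _, _, _, _, _, d7⟩ := ManifoldA.manifold_dictionary L (by omega) hΔ0 hΔ1 hf
  rw [← etaEff_eq L (by omega) hf.1, d7]
  have hπ : Real.pi ^ 2 ≠ 0 := by positivity
  field_simp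

end Summit.HubbardSuperconductivity.HubbardSuperconductivity.Theorems.AnisotropyChord.Transfer.Fibre3.L2.N1
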